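import Summits.Ventures.Crystal3D.Theorems.StickyWulffConstantTextureLiminfTexShadowLevelReachPlatesFluxArea
import Summits.Ventures.Crystal3D.Theorems.StickyWulffConstantTextureLiminfTexShadowLevelReachHexagonPooledFluxRoot
import HarnessLib

/-!
# (β) plates side, input (b): FLUX-TO-AREA in the CELL — the two plate instances and the composition with the pooled theorems
# (lane T, crux `TextureLiminfV5`, stmt-Ventures-23912, registered stub `stub_terraceCensus`; BETA-PLATES-g23 §3 (i) / §4 (3); cf-p1 (cccxvii))

HONEST FRAMING. Venture `Summits/Ventures/Crystal3D` (cell `crystal3d-full`), route `route-Ventures-StickyWulffConstant`, helper `--supports` the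
law-v5 crux `TextureLiminfV5` (stmt-Ventures-23912), lane T.  Bookkeeping only, standard axioms; census-free, certificate-free (the rows
`LocalEndRowA` / `LocalEndRowRootA` stay HYPOTHESES BY NAME); nothing about energies; F-C1 not moved.

The abstract flux-to-area theorems of …LevelReachPlatesFluxArea (`plate_flux_ge_area`, `plate_flux_two_types_ge_area`) take `0 ≤ V ≤ n·S` and
`ν² ≤ 1` as hypotheses.  Here they are discharged for the two plates of the clamped two-plate cell, in the VERBATIM flux shapes of
`hexagon_twoPlate_flux_le_payerSum` (p748129):
* `symm_e₃_two_sq_le_one`, `basal_apply_two_abs_le` — `ν₂² ≤ 1` and `|(L r)₂| ≤ S = √(1 − ν₂²)` for a unit basal `r` (Cauchy–Schwarz in the plane);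
* `sum_inPlaneRoots_rise_le` / `sum_inPlaneRoots_fall_le` — `0 ≤ V ≤ #RT·S` for `V = Σ_{r ∈ inPlaneRoots Fr 1} (Fr r)₂` (`Fr r = L r` on basal `r`)
  and `V = Σ_{r ∈ inPlaneRoots G (−1)} −(G r)₂`; `inPlaneRoots_basalMirror_trans` (+ the sum) — the two TYPES of one plate have the same `RT` and `V`;
* `sum_inPlaneRoots_rise_ge_sqrt3` / `sum_inPlaneRoots_fall_ge_sqrt3` — `√3·S ≤ V` for both plates (lane F's `four_div_sqrt_le_phi`, i.e.
  `sum_inPlane_rising_ge`, transported to the top frame through `G ≫ bM`); `tilt_area_le_root_area` — hence `√6·π·(S₁+S₂)·(ρ−4)² ≤ √2·π·(V₁+V₂)·(ρ−4)²`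
  (TILT currency: `S_i = √(1 − ν_{i,2}²)` is the sine of plate `i`'s basal tilt to the wall);
* **`bottomPlate_flux_ge_area`** / **`topPlate_flux_ge_area`** — `√2·π·V_i·(ρ−4)² − 5·#RT_i·ρ ≤ flux_i(Kw⋆_i)` when every layer of the canonical
  window is admissible for the chosen type (+ primed `∃ Kw` forms under «every layer admissible»); **`bottomPlate_flux_two_types_ge_area`** — the
  two-type form for the bottom plate, any word (frames `L₁` and `bM ≫ L₁`, one profitable window);
* **`hexagon_twoPlate_area_le_payerSum`** (+ `…_root`) — composed with p748129 (resp. p749435):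
  `√2·π·(V₁ + V₂)·(ρ−4)² ≤ sF·Σ_PAY(12 − deg) + ΣCUT₁ + ΣCUT₂ + (3456·sF + 1710840)·ρ` under the row by name and the two admissibility hypotheses.
WHAT THIS IS NOT: the row, the CUT bounds, the born-line supply, the assembly, any evaluation of `V₁ + V₂` against `2·sF·(13/25)`; F-C1 not moved.
-/

noncomputable section

namespace Summit.Ventures.Crystal3D.Theorems

open Summit.Ventures.Crystal3D Finset
open Literature.Algebra.EuclideanLattices (inner_fin_three norm_sq_fin_three)
open Literature.MathematicalPhysics.StatisticalMechanics (IsHaggSeq basalMirror)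
open Summit.Ventures.Crystal3D.Cruxes.TextureLiminf.TexShadow (E3 stacking)
open scoped InnerProductSpace

/-! ## The plate data: `ν₂² ≤ 1`, `0 ≤ V ≤ #RT · S` -/

/-- The vertical coordinate of the pulled-back wall normal has square at most `1`. -/
theorem symm_e₃_two_sq_le_one (L : E3 ≃ₗᵢ[ℝ] E3) : ((L.symm (EuclideanSpace.single (2 : Fin 3) (1 : ℝ))) 2) ^ 2 ≤ 1 := by
  set ν : E3 := L.symm (EuclideanSpace.single (2 : Fin 3) (1 : ℝ)) with hν
  have hνn : ‖ν‖ = 1 := by rw [hν, LinearIsometryEquiv.norm_map, PiLp.norm_single, norm_one]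
  have h := norm_sq_fin_three ν
  rw [hνn, one_pow] at h
  nlinarith [sq_nonneg (ν 0), sq_nonneg (ν 1)]

/-- **The rise of a unit basal vector is at most the sine of the tilt**: `|(L r)₂| ≤ √(1 − ν₂²)` for `‖r‖ = 1`, `r₂ = 0`, `ν = L⁻¹e₃`. -/
theorem basal_apply_two_abs_le (L : E3 ≃ₗᵢ[ℝ] E3) {r : E3} (hr1 : ‖r‖ = 1) (hr2 : r 2 = 0) :
    |(L r) 2| ≤ Real.sqrt (1 - ((L.symm (EuclideanSpace.single (2 : Fin 3) (1 : ℝ))) 2) ^ 2) := by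
  set e : E3 := EuclideanSpace.single (2 : Fin 3) (1 : ℝ) with he
  set ν : E3 := L.symm e with hν
  have hνn : ‖ν‖ = 1 := by rw [hν, LinearIsometryEquiv.norm_map, he, PiLp.norm_single, norm_one]
  have h2 : (L r) 2 = ⟪r, ν⟫_ℝ := by
    have : (L r) 2 = ⟪L r, e⟫_ℝ := by rw [he, EuclideanSpace.inner_single_right]; simp
    rw [this, hν, ← LinearIsometryEquiv.inner_map_map L r (L.symm e), LinearIsometryEquiv.apply_symm_apply]
  rw [h2, inner_fin_three, hr2, zero_mul, add_zero]
  have hr : r 0 ^ 2 + r 1 ^ 2 = 1 := by have := norm_sq_fin_three r; rw [hr1, hr2] at this; nlinarith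
  have hνs : ν 0 ^ 2 + ν 1 ^ 2 = 1 - ν 2 ^ 2 := by have := norm_sq_fin_three ν; rw [hνn] at this; nlinarith
  refine Real.abs_le_sqrt ?_
  nlinarith [sq_nonneg (r 0 * ν 1 - r 1 * ν 0)]

/-- **Rising in-plane roots**: `0 ≤ Σ_{r ∈ inPlaneRoots Fr 1} (Fr r)₂ ≤ #RT · √(1 − ν₂²)` when `Fr r = L r` on basal `r`. -/
theorem sum_inPlaneRoots_rise_le (L Fr : E3 ≃ₗᵢ[ℝ] E3) (hFrL : ∀ r : E3, r 2 = 0 → Fr r = L r) :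
    0 ≤ ∑ r ∈ inPlaneRoots Fr 1, (Fr r) 2 ∧
      ∑ r ∈ inPlaneRoots Fr 1, (Fr r) 2 ≤
        ((inPlaneRoots Fr 1).card : ℕ) * Real.sqrt (1 - ((L.symm (EuclideanSpace.single (2 : Fin 3) (1 : ℝ))) 2) ^ 2) := by
  have hmem : ∀ r ∈ inPlaneRoots Fr 1, r ∈ fccSlots ∧ r 2 = 0 ∧ 0 < (Fr r) 2 := by
    intro r hr
    obtain ⟨hrS, hr2, hup⟩ := mem_filter.1 hr
    exact ⟨hrS, hr2, by linarith⟩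
  refine ⟨sum_nonneg fun r hr => (hmem r hr).2.2.le, ?_⟩
  rw [← nsmul_eq_mul, ← Finset.sum_const]
  refine sum_le_sum fun r hr => ?_
  obtain ⟨hrS, hr2, -⟩ := hmem r hr
  rw [hFrL r hr2]
  exact (le_abs_self _).trans (basal_apply_two_abs_le L (norm_eq_one_of_mem_fccSlots hrS) hr2)

/-- **Falling in-plane roots**: `0 ≤ Σ_{r ∈ inPlaneRoots G (−1)} −(G r)₂ ≤ #RT · √(1 − ν₂²)` when `G r = L r` on basal `r`. -/
theorem sum_inPlaneRoots_fall_le (L G : E3 ≃ₗᵢ[ℝ] E3) (hGL : ∀ r : E3, r 2 = 0 → G r = L r) :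
    0 ≤ ∑ r ∈ inPlaneRoots G (-1), -(G r) 2 ∧
      ∑ r ∈ inPlaneRoots G (-1), -(G r) 2 ≤
        ((inPlaneRoots G (-1)).card : ℕ) * Real.sqrt (1 - ((L.symm (EuclideanSpace.single (2 : Fin 3) (1 : ℝ))) 2) ^ 2) := by
  have hmem : ∀ r ∈ inPlaneRoots G (-1), r ∈ fccSlots ∧ r 2 = 0 ∧ (G r) 2 < 0 := by
    intro r hr
    obtain ⟨hrS, hr2, hup⟩ := mem_filter.1 hr
    exact ⟨hrS, hr2, by linarith⟩
  refine ⟨sum_nonneg fun r hr => by linarith [(hmem r hr).2.2], ?_⟩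
  rw [← nsmul_eq_mul, ← Finset.sum_const]
  refine sum_le_sum fun r hr => ?_
  obtain ⟨hrS, hr2, -⟩ := hmem r hr
  rw [hGL r hr2]
  exact (neg_le_abs _).trans (basal_apply_two_abs_le L (norm_eq_one_of_mem_fccSlots hrS) hr2)

/-- `bM ≫ L` (first the basal mirror) has the same in-plane roots as `L`: the basal mirror fixes basal vectors. -/
theorem inPlaneRoots_basalMirror_trans (L : E3 ≃ₗᵢ[ℝ] E3) (s : ℝ) :
    inPlaneRoots (basalMirror.trans L) s = inPlaneRoots L s := by
  unfold inPlaneRoots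
  refine filter_congr fun r _ => ?_
  constructor
  · rintro ⟨hr2, h⟩
    exact ⟨hr2, by rwa [frame_apply_basal (t := -1) (Or.inr ⟨rfl, rfl⟩) hr2] at h⟩
  · rintro ⟨hr2, h⟩
    exact ⟨hr2, by rwa [frame_apply_basal (t := -1) (Or.inr ⟨rfl, rfl⟩) hr2]⟩

/-- The two types of one plate have the same `V`. -/
theorem sum_inPlaneRoots_basalMirror_trans (L : E3 ≃ₗᵢ[ℝ] E3) (s : ℝ) :
    ∑ r ∈ inPlaneRoots (basalMirror.trans L) s, ((basalMirror.trans L) r) 2 = ∑ r ∈ inPlaneRoots L s, (L r) 2 := by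
  rw [inPlaneRoots_basalMirror_trans]
  refine sum_congr rfl fun r hr => ?_
  rw [frame_apply_basal (t := -1) (Or.inr ⟨rfl, rfl⟩) (mem_filter.1 hr).2.1]

/-- **The rising in-plane roots carry at least `√3 · S`** (`sum_inPlane_rising_ge` / `four_div_sqrt_le_phi`, lane F): `√3·√(1 − ν₂²) ≤ V`. -/
theorem sum_inPlaneRoots_rise_ge_sqrt3 {L Fr : E3 ≃ₗᵢ[ℝ] E3} {t : ℤ}
    (hFr : (t = 1 ∧ Fr = L) ∨ (t = -1 ∧ Fr = basalMirror.trans L)) :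
    Real.sqrt 3 * Real.sqrt (1 - ((L.symm (EuclideanSpace.single (2 : Fin 3) (1 : ℝ))) 2) ^ 2) ≤
      ∑ r ∈ inPlaneRoots Fr 1, (Fr r) 2 := by
  set S2 : ℝ := 1 - ((L.symm (EuclideanSpace.single (2 : Fin 3) (1 : ℝ))) 2) ^ 2 with hS2
  rcases eq_or_lt_of_le (show 0 ≤ S2 by have := symm_e₃_two_sq_le_one L; rw [hS2]; linarith) with h0 | hpos
  · rw [← h0, Real.sqrt_zero, mul_zero]
    exact (sum_inPlaneRoots_rise_le L Fr (fun r hr => frame_apply_basal hFr hr)).1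
  · have key := four_div_sqrt_le_phi hFr hpos
    have hS : 0 < Real.sqrt S2 := Real.sqrt_pos.2 hpos
    have h3 : 0 < Real.sqrt 3 := by positivity
    have hSS : Real.sqrt S2 * Real.sqrt S2 = S2 := Real.mul_self_sqrt hpos.le
    rw [div_le_div_iff₀ hS (mul_pos h3 hpos)] at key
    -- `4 · (√3 · S2) ≤ 4 V · √S2` ⇒ `√3 √S2 ≤ V`
    have key' : Real.sqrt 3 * S2 ≤ (∑ r ∈ inPlaneRoots Fr 1, (Fr r) 2) * Real.sqrt S2 := by nlinarith [key]
    have : Real.sqrt 3 * Real.sqrt S2 * Real.sqrt S2 ≤ (∑ r ∈ inPlaneRoots Fr 1, (Fr r) 2) * Real.sqrt S2 := by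
      rw [mul_assoc, hSS]; exact key'
    exact le_of_mul_le_mul_right this hS

/-- **The falling in-plane roots of the top frame carry at least `√3 · S`** (the mirrored frame `G ≫ bM` rises). -/
theorem sum_inPlaneRoots_fall_ge_sqrt3 {L G : E3 ≃ₗᵢ[ℝ] E3} {t' : ℤ}
    (hG : (t' = 1 ∧ G = L) ∨ (t' = -1 ∧ G = basalMirror.trans L)) :
    Real.sqrt 3 * Real.sqrt (1 - ((L.symm (EuclideanSpace.single (2 : Fin 3) (1 : ℝ))) 2) ^ 2) ≤
      ∑ r ∈ inPlaneRoots G (-1), -(G r) 2 := by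
  have hFr' : (t' = 1 ∧ G.trans basalMirror = L.trans basalMirror) ∨
      (t' = -1 ∧ G.trans basalMirror = basalMirror.trans (L.trans basalMirror)) := by
    rcases hG with ⟨ht, h⟩ | ⟨ht, h⟩
    · exact Or.inl ⟨ht, by rw [h]⟩
    · exact Or.inr ⟨ht, by rw [h]; exact LinearIsometryEquiv.ext fun x => rfl⟩
  have key := sum_inPlaneRoots_rise_ge_sqrt3 hFr'
  rw [symm_e₃_two_trans_basalMirror, neg_sq, inPlaneRoots_trans_basalMirror] at key
  refine key.trans (le_of_eq (sum_congr rfl fun r _ => ?_))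
  rw [trans_basalMirror_apply_two]

/-- **Root-sum currency ⇒ tilt currency**: with `√3·S_i ≤ V_i` (the two lemmas above), `√6·π·(S₁ + S₂)·(ρ−4)² ≤ √2·π·(V₁ + V₂)·(ρ−4)²` — one
`le_trans` turns `hexagon_twoPlate_area_le_payerSum` into a bound by the two basal-tilt sines alone. -/
theorem tilt_area_le_root_area {S₁ S₂ V₁ V₂ : ℝ} (h₁ : Real.sqrt 3 * S₁ ≤ V₁) (h₂ : Real.sqrt 3 * S₂ ≤ V₂) (ρ : ℝ) :
    Real.sqrt 6 * Real.pi * (S₁ + S₂) * (ρ - 4) ^ 2 ≤ Real.sqrt 2 * Real.pi * (V₁ + V₂) * (ρ - 4) ^ 2 := by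
  have h6 : Real.sqrt 6 = Real.sqrt 2 * Real.sqrt 3 := by
    rw [← Real.sqrt_mul (by norm_num : (0:ℝ) ≤ 2)]; norm_num
  rw [h6]
  have hc : 0 ≤ Real.sqrt 2 * Real.pi * (ρ - 4) ^ 2 := by positivity
  have key : Real.sqrt 3 * (S₁ + S₂) ≤ V₁ + V₂ := by linarith
  calc Real.sqrt 2 * Real.sqrt 3 * Real.pi * (S₁ + S₂) * (ρ - 4) ^ 2
      = (Real.sqrt 2 * Real.pi * (ρ - 4) ^ 2) * (Real.sqrt 3 * (S₁ + S₂)) := by ring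
    _ ≤ (Real.sqrt 2 * Real.pi * (ρ - 4) ^ 2) * (V₁ + V₂) := mul_le_mul_of_nonneg_left key hc
    _ = Real.sqrt 2 * Real.pi * (V₁ + V₂) * (ρ - 4) ^ 2 := by ring

/-! ## The two plate instances -/

open scoped Classical in
/-- **FLUX-TO-AREA, bottom plate** (`Fr ∈ {L₁, bM ≫ L₁}` of type `t`; every layer of the canonical window `t`-admissible). -/
theorem bottomPlate_flux_ge_area (σ₁ : ℤ → ℤ) (L₁ : E3 ≃ₗᵢ[ℝ] E3) (s₁ : E3) (Fr : E3 ≃ₗᵢ[ℝ] E3) {t : ℤ}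
    (hFr : (t = 1 ∧ Fr = L₁) ∨ (t = -1 ∧ Fr = basalMirror.trans L₁)) (R₀ ρ : ℝ) (hρ : 4 ≤ ρ)
    (hadm : ∀ k ∈ Finset.Icc
        ⌈(-((ρ - 4) * Real.sqrt (1 - (L₁.symm (EuclideanSpace.single (2 : Fin 3) (1 : ℝ))) 2 ^ 2)) -
            ((L₁.symm s₁) 2 - (-(R₀ + 1) - 1) * (L₁.symm (EuclideanSpace.single (2 : Fin 3) (1 : ℝ))) 2)) / Real.sqrt (2 / 3)⌉
        ⌊((ρ - 4) * Real.sqrt (1 - (L₁.symm (EuclideanSpace.single (2 : Fin 3) (1 : ℝ))) 2 ^ 2) -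
            ((L₁.symm s₁) 2 - (-(R₀ + 1) - 1) * (L₁.symm (EuclideanSpace.single (2 : Fin 3) (1 : ℝ))) 2)) / Real.sqrt (2 / 3)⌋,
        ¬ (σ₁ (k - 1) = -t ∧ σ₁ k = -t)) :
    Real.sqrt 2 * Real.pi * (∑ r ∈ inPlaneRoots Fr 1, (Fr r) 2) * (ρ - 4) ^ 2 - 5 * ((inPlaneRoots Fr 1).card : ℕ) * ρ ≤
      ∑ k ∈ Finset.Icc
        ⌈(-((ρ - 4) * Real.sqrt (1 - (L₁.symm (EuclideanSpace.single (2 : Fin 3) (1 : ℝ))) 2 ^ 2)) -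
            ((L₁.symm s₁) 2 - (-(R₀ + 1) - 1) * (L₁.symm (EuclideanSpace.single (2 : Fin 3) (1 : ℝ))) 2)) / Real.sqrt (2 / 3)⌉
        ⌊((ρ - 4) * Real.sqrt (1 - (L₁.symm (EuclideanSpace.single (2 : Fin 3) (1 : ℝ))) 2 ^ 2) -
            ((L₁.symm s₁) 2 - (-(R₀ + 1) - 1) * (L₁.symm (EuclideanSpace.single (2 : Fin 3) (1 : ℝ))) 2)) / Real.sqrt (2 / 3)⌋,
        (if ¬ (σ₁ (k - 1) = -t ∧ σ₁ k = -t) then (1 : ℝ) else 0) *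
        (4 * (∑ r ∈ inPlaneRoots Fr 1, (Fr r) 2) / (Real.sqrt 3 * (1 - (L₁.symm (EuclideanSpace.single (2 : Fin 3) (1 : ℝ))) 2 ^ 2)) *
          Real.sqrt (max 0 ((ρ - 4) ^ 2 * (1 - (L₁.symm (EuclideanSpace.single (2 : Fin 3) (1 : ℝ))) 2 ^ 2) -
            ((k : ℝ) * Real.sqrt (2 / 3) + (L₁.symm s₁) 2 -
              (-(R₀ + 1) - 1) * (L₁.symm (EuclideanSpace.single (2 : Fin 3) (1 : ℝ))) 2) ^ 2)) -
          ((inPlaneRoots Fr 1).card : ℝ)) := by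
  obtain ⟨hV0, hVS⟩ := sum_inPlaneRoots_rise_le L₁ Fr (fun r hr => frame_apply_basal hFr hr)
  exact plate_flux_ge_area σ₁ t _ _ _ _ ρ _ hρ (symm_e₃_two_sq_le_one L₁) hV0 hVS hadm

open scoped Classical in
/-- **FLUX-TO-AREA, top plate** (`G₂ ∈ {L₂, bM ≫ L₂}` of type `t'`, falling in-plane roots, slice height `h+(R₀+1)+1`; every layer of the canonical
window `t'`-admissible). -/
theorem topPlate_flux_ge_area (σ₂ : ℤ → ℤ) (L₂ : E3 ≃ₗᵢ[ℝ] E3) (s₂ : E3) (G₂ : E3 ≃ₗᵢ[ℝ] E3) {t' : ℤ}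
    (hG₂ : (t' = 1 ∧ G₂ = L₂) ∨ (t' = -1 ∧ G₂ = basalMirror.trans L₂)) (R₀ h ρ : ℝ) (hρ : 4 ≤ ρ)
    (hadm : ∀ k ∈ Finset.Icc
        ⌈(-((ρ - 4) * Real.sqrt (1 - (L₂.symm (EuclideanSpace.single (2 : Fin 3) (1 : ℝ))) 2 ^ 2)) -
            ((L₂.symm s₂) 2 - (h + (R₀ + 1) + 1) * (L₂.symm (EuclideanSpace.single (2 : Fin 3) (1 : ℝ))) 2)) / Real.sqrt (2 / 3)⌉
        ⌊((ρ - 4) * Real.sqrt (1 - (L₂.symm (EuclideanSpace.single (2 : Fin 3) (1 : ℝ))) 2 ^ 2) -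
            ((L₂.symm s₂) 2 - (h + (R₀ + 1) + 1) * (L₂.symm (EuclideanSpace.single (2 : Fin 3) (1 : ℝ))) 2)) / Real.sqrt (2 / 3)⌋,
        ¬ (σ₂ (k - 1) = -t' ∧ σ₂ k = -t')) :
    Real.sqrt 2 * Real.pi * (∑ r ∈ inPlaneRoots G₂ (-1), -(G₂ r) 2) * (ρ - 4) ^ 2 - 5 * ((inPlaneRoots G₂ (-1)).card : ℕ) * ρ ≤
      ∑ k ∈ Finset.Icc
        ⌈(-((ρ - 4) * Real.sqrt (1 - (L₂.symm (EuclideanSpace.single (2 : Fin 3) (1 : ℝ))) 2 ^ 2)) -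
            ((L₂.symm s₂) 2 - (h + (R₀ + 1) + 1) * (L₂.symm (EuclideanSpace.single (2 : Fin 3) (1 : ℝ))) 2)) / Real.sqrt (2 / 3)⌉
        ⌊((ρ - 4) * Real.sqrt (1 - (L₂.symm (EuclideanSpace.single (2 : Fin 3) (1 : ℝ))) 2 ^ 2) -
            ((L₂.symm s₂) 2 - (h + (R₀ + 1) + 1) * (L₂.symm (EuclideanSpace.single (2 : Fin 3) (1 : ℝ))) 2)) / Real.sqrt (2 / 3)⌋,
        (if ¬ (σ₂ (k - 1) = -t' ∧ σ₂ k = -t') then (1 : ℝ) else 0) *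
        (4 * (∑ r ∈ inPlaneRoots G₂ (-1), -(G₂ r) 2) / (Real.sqrt 3 * (1 - (L₂.symm (EuclideanSpace.single (2 : Fin 3) (1 : ℝ))) 2 ^ 2)) *
          Real.sqrt (max 0 ((ρ - 4) ^ 2 * (1 - (L₂.symm (EuclideanSpace.single (2 : Fin 3) (1 : ℝ))) 2 ^ 2) -
            ((k : ℝ) * Real.sqrt (2 / 3) + (L₂.symm s₂) 2 -
              (h + (R₀ + 1) + 1) * (L₂.symm (EuclideanSpace.single (2 : Fin 3) (1 : ℝ))) 2) ^ 2)) -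
          ((inPlaneRoots G₂ (-1)).card : ℝ)) := by
  obtain ⟨hV0, hVS⟩ := sum_inPlaneRoots_fall_le L₂ G₂ (fun r hr => frame_apply_basal hG₂ hr)
  exact plate_flux_ge_area σ₂ t' _ _ _ _ ρ _ hρ (symm_e₃_two_sq_le_one L₂) hV0 hVS hadm

open scoped Classical in
/-- **Bottom plate, packaged**: for a word ALL of whose layers are `t`-admissible (hcp-like words for both types, the fcc word of type `t`) there is a
layer window on which the flux dominates the area term. -/
theorem bottomPlate_flux_ge_area' (σ₁ : ℤ → ℤ) (L₁ : E3 ≃ₗᵢ[ℝ] E3) (s₁ : E3) (Fr : E3 ≃ₗᵢ[ℝ] E3) {t : ℤ}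
    (hFr : (t = 1 ∧ Fr = L₁) ∨ (t = -1 ∧ Fr = basalMirror.trans L₁)) (R₀ ρ : ℝ) (hρ : 4 ≤ ρ)
    (hadm : ∀ k : ℤ, ¬ (σ₁ (k - 1) = -t ∧ σ₁ k = -t)) :
    ∃ Kw : Finset ℤ,
      Real.sqrt 2 * Real.pi * (∑ r ∈ inPlaneRoots Fr 1, (Fr r) 2) * (ρ - 4) ^ 2 - 5 * ((inPlaneRoots Fr 1).card : ℕ) * ρ ≤
      ∑ k ∈ Kw, (if ¬ (σ₁ (k - 1) = -t ∧ σ₁ k = -t) then (1 : ℝ) else 0) *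
        (4 * (∑ r ∈ inPlaneRoots Fr 1, (Fr r) 2) / (Real.sqrt 3 * (1 - (L₁.symm (EuclideanSpace.single (2 : Fin 3) (1 : ℝ))) 2 ^ 2)) *
          Real.sqrt (max 0 ((ρ - 4) ^ 2 * (1 - (L₁.symm (EuclideanSpace.single (2 : Fin 3) (1 : ℝ))) 2 ^ 2) -
            ((k : ℝ) * Real.sqrt (2 / 3) + (L₁.symm s₁) 2 -
              (-(R₀ + 1) - 1) * (L₁.symm (EuclideanSpace.single (2 : Fin 3) (1 : ℝ))) 2) ^ 2)) -
          ((inPlaneRoots Fr 1).card : ℝ)) :=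
  ⟨_, bottomPlate_flux_ge_area σ₁ L₁ s₁ Fr hFr R₀ ρ hρ fun k _ => hadm k⟩

open scoped Classical in
/-- **Top plate, packaged** (all layers `t'`-admissible). -/
theorem topPlate_flux_ge_area' (σ₂ : ℤ → ℤ) (L₂ : E3 ≃ₗᵢ[ℝ] E3) (s₂ : E3) (G₂ : E3 ≃ₗᵢ[ℝ] E3) {t' : ℤ}
    (hG₂ : (t' = 1 ∧ G₂ = L₂) ∨ (t' = -1 ∧ G₂ = basalMirror.trans L₂)) (R₀ h ρ : ℝ) (hρ : 4 ≤ ρ)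
    (hadm : ∀ k : ℤ, ¬ (σ₂ (k - 1) = -t' ∧ σ₂ k = -t')) :
    ∃ Kw : Finset ℤ,
      Real.sqrt 2 * Real.pi * (∑ r ∈ inPlaneRoots G₂ (-1), -(G₂ r) 2) * (ρ - 4) ^ 2 - 5 * ((inPlaneRoots G₂ (-1)).card : ℕ) * ρ ≤
      ∑ k ∈ Kw, (if ¬ (σ₂ (k - 1) = -t' ∧ σ₂ k = -t') then (1 : ℝ) else 0) *
        (4 * (∑ r ∈ inPlaneRoots G₂ (-1), -(G₂ r) 2) / (Real.sqrt 3 * (1 - (L₂.symm (EuclideanSpace.single (2 : Fin 3) (1 : ℝ))) 2 ^ 2)) *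
          Real.sqrt (max 0 ((ρ - 4) ^ 2 * (1 - (L₂.symm (EuclideanSpace.single (2 : Fin 3) (1 : ℝ))) 2 ^ 2) -
            ((k : ℝ) * Real.sqrt (2 / 3) + (L₂.symm s₂) 2 -
              (h + (R₀ + 1) + 1) * (L₂.symm (EuclideanSpace.single (2 : Fin 3) (1 : ℝ))) 2) ^ 2)) -
          ((inPlaneRoots G₂ (-1)).card : ℝ)) :=
  ⟨_, topPlate_flux_ge_area σ₂ L₂ s₂ G₂ hG₂ R₀ h ρ hρ fun k _ => hadm k⟩

open scoped Classical in
/-- **Bottom plate, TWO TYPES, any word**: the fluxes of the two root frames `L₁` (type `1`) and `bM ≫ L₁` (type `−1`) on ONE common window together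
dominate the area term of `L₁` (same `RT`, same `V`: `inPlaneRoots_basalMirror_trans`). -/
theorem bottomPlate_flux_two_types_ge_area (σ₁ : ℤ → ℤ) (L₁ : E3 ≃ₗᵢ[ℝ] E3) (s₁ : E3) (R₀ ρ : ℝ) (hρ : 4 ≤ ρ) :
    ∃ Kw : Finset ℤ,
      Real.sqrt 2 * Real.pi * (∑ r ∈ inPlaneRoots L₁ 1, (L₁ r) 2) * (ρ - 4) ^ 2 - 5 * ((inPlaneRoots L₁ 1).card : ℕ) * ρ ≤
      ∑ k ∈ Kw, (if ¬ (σ₁ (k - 1) = -1 ∧ σ₁ k = -1) then (1 : ℝ) else 0) *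
        (4 * (∑ r ∈ inPlaneRoots L₁ 1, (L₁ r) 2) / (Real.sqrt 3 * (1 - (L₁.symm (EuclideanSpace.single (2 : Fin 3) (1 : ℝ))) 2 ^ 2)) *
          Real.sqrt (max 0 ((ρ - 4) ^ 2 * (1 - (L₁.symm (EuclideanSpace.single (2 : Fin 3) (1 : ℝ))) 2 ^ 2) -
            ((k : ℝ) * Real.sqrt (2 / 3) + (L₁.symm s₁) 2 -
              (-(R₀ + 1) - 1) * (L₁.symm (EuclideanSpace.single (2 : Fin 3) (1 : ℝ))) 2) ^ 2)) -
          ((inPlaneRoots L₁ 1).card : ℝ)) +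
      ∑ k ∈ Kw, (if ¬ (σ₁ (k - 1) = -(-1) ∧ σ₁ k = -(-1)) then (1 : ℝ) else 0) *
        (4 * (∑ r ∈ inPlaneRoots (basalMirror.trans L₁) 1, ((basalMirror.trans L₁) r) 2) /
            (Real.sqrt 3 * (1 - (L₁.symm (EuclideanSpace.single (2 : Fin 3) (1 : ℝ))) 2 ^ 2)) *
          Real.sqrt (max 0 ((ρ - 4) ^ 2 * (1 - (L₁.symm (EuclideanSpace.single (2 : Fin 3) (1 : ℝ))) 2 ^ 2) -
            ((k : ℝ) * Real.sqrt (2 / 3) + (L₁.symm s₁) 2 -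
              (-(R₀ + 1) - 1) * (L₁.symm (EuclideanSpace.single (2 : Fin 3) (1 : ℝ))) 2) ^ 2)) -
          ((inPlaneRoots (basalMirror.trans L₁) 1).card : ℝ)) := by
  rw [sum_inPlaneRoots_basalMirror_trans, inPlaneRoots_basalMirror_trans]
  obtain ⟨hV0, hVS⟩ := sum_inPlaneRoots_rise_le L₁ L₁ (fun r _ => rfl)
  exact ⟨_, plate_flux_two_types_ge_area σ₁ (t := 1) (t' := -1) (by norm_num) _ _ _ _ ρ _ hρ (symm_e₃_two_sq_le_one L₁) hV0 hVS⟩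

/-! ## Composition with the pooled theorems: the (β) plates side in AREA currency -/

open scoped Classical in
/-- **Both plates pooled under ONE `LocalEndRowA`, area form**: `hexagon_twoPlate_flux_le_payerSum` (p748129) with the fluxes evaluated against the
area (`#RT ≤ 12` absorbs the `5·#RT·ρ` terms): for words all of whose layers are admissible for the chosen types,
`√2·π·(V₁ + V₂)·(ρ−4)² ≤ sF·Σ_PAY(12 − deg) + ΣCUT₁ + ΣCUT₂ + (3456·sF + 1710840)·ρ`. -/
theorem hexagon_twoPlate_area_le_payerSum (ver : WordVersion) {δ : ℝ} (hg : KissingGap δ) (hc : KissingClassification δ)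
    {σ₁ σ₂ : ℤ → ℤ} (hσ₁ : IsHaggSeq σ₁) (hσ₂ : IsHaggSeq σ₂) (L₁ L₂ : E3 ≃ₗᵢ[ℝ] E3) (s₁ s₂ : E3)
    (Fr : E3 ≃ₗᵢ[ℝ] E3) {t : ℤ} (hFr : (t = 1 ∧ Fr = L₁) ∨ (t = -1 ∧ Fr = basalMirror.trans L₁))
    (G₂ : E3 ≃ₗᵢ[ℝ] E3) {t' : ℤ} (hG₂ : (t' = 1 ∧ G₂ = L₂) ∨ (t' = -1 ∧ G₂ = basalMirror.trans L₂))
    (hne₁ : (Fr : E3 → E3) '' ↑fccSlots ≠ (L₂ : E3 → E3) '' ↑fccSlots)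
    (hne₂ : (Fr : E3 → E3) '' ↑fccSlots ≠ ((basalMirror.trans L₂ : E3 ≃ₗᵢ[ℝ] E3) : E3 → E3) '' ↑fccSlots)
    (hne₁' : (G₂ : E3 → E3) '' ↑fccSlots ≠ (L₁ : E3 → E3) '' ↑fccSlots)
    (hne₂' : (G₂ : E3 → E3) '' ↑fccSlots ≠ ((basalMirror.trans L₁ : E3 ≃ₗᵢ[ℝ] E3) : E3 → E3) '' ↑fccSlots)
    {sF : ℝ} (hsF : 0 ≤ sF) (hrow : LocalEndRowA ver sF ⟨Fr, inPlaneRoots Fr 1⟩ ⟨G₂, inPlaneRoots G₂ (-1)⟩)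
    (hadm₁ : ∀ k : ℤ, ¬ (σ₁ (k - 1) = -t ∧ σ₁ k = -t)) (hadm₂ : ∀ k : ℤ, ¬ (σ₂ (k - 1) = -t' ∧ σ₂ k = -t'))
    (X P₁ P₂ : Finset E3) (R₀ h ρ : ℝ) (hR₀ : 5 ≤ R₀) (hh : 0 ≤ h) (hρ : R₀ + 2 ≤ ρ)
    (hX : ∀ p ∈ X, ∀ q ∈ X, p ≠ q → 1 ≤ dist p q) (hP₁X : P₁ ⊆ X) (hP₂X : P₂ ⊆ X)
    (hcell : ∀ p ∈ X, -(2 * R₀) ≤ p 2 ∧ p 2 ≤ h + 2 * R₀ ∧ p 0 ^ 2 + p 1 ^ 2 ≤ ρ ^ 2)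
    (hP₁ : ∀ p, p ∈ P₁ ↔ (p ∈ stacking L₁ s₁ σ₁ ∧ -(2 * R₀) ≤ p 2 ∧ p 2 ≤ -R₀ ∧ p 0 ^ 2 + p 1 ^ 2 ≤ ρ ^ 2))
    (hP₂ : ∀ p, p ∈ P₂ ↔ (p ∈ stacking L₂ s₂ σ₂ ∧ h + R₀ ≤ p 2 ∧ p 2 ≤ h + 2 * R₀ ∧ p 0 ^ 2 + p 1 ^ 2 ≤ ρ ^ 2)) :
    Real.sqrt 2 * Real.pi * ((∑ r ∈ inPlaneRoots Fr 1, (Fr r) 2) + ∑ r ∈ inPlaneRoots G₂ (-1), -(G₂ r) 2) * (ρ - 4) ^ 2 ≤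
      sF * ∑ y ∈ X.filter (fun y => (X.filter fun q => dist y q = 1).card ≠ 12 ∧ -R₀ - 2 ≤ y 2 ∧ y 2 ≤ h + R₀ + 2),
          ((12 : ℝ) - ((X.filter fun q => dist y q = 1).card : ℝ)) +
        ((∑ r ∈ inPlaneRoots Fr 1, (X.filter fun b => -(R₀ + 1) - 1 ≤ b 2 ∧ b 2 < h + (R₀ + 1) + 1 ∧
            (∃ μ, ⟪r, μ⟫_ℝ = Real.sqrt (2 / 3) ∧ IsTwinReading X Fr (Fr μ) b) ∧ b - Fr r ∈ X).card : ℕ) : ℝ) +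
        ((∑ r ∈ inPlaneRoots G₂ (-1), (X.filter fun b => -(R₀ + 1) - 1 < b 2 ∧ b 2 ≤ h + (R₀ + 1) + 1 ∧
            (∃ μ, ⟪r, μ⟫_ℝ = Real.sqrt (2 / 3) ∧ IsTwinReading X G₂ (G₂ μ) b) ∧ b - G₂ r ∈ X).card : ℕ) : ℝ) +
        (3456 * sF + 1710840) * ρ := by
  have hρ4 : 4 ≤ ρ := by linarith
  obtain ⟨Kw₁, h1⟩ := bottomPlate_flux_ge_area' σ₁ L₁ s₁ Fr hFr R₀ ρ hρ4 hadm₁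
  obtain ⟨Kw₂, h2⟩ := topPlate_flux_ge_area' σ₂ L₂ s₂ G₂ hG₂ R₀ h ρ hρ4 hadm₂
  have hflux := hexagon_twoPlate_flux_le_payerSum ver hg hc hσ₁ hσ₂ L₁ L₂ s₁ s₂ Fr hFr G₂ hG₂ hne₁ hne₂ hne₁' hne₂' hsF hrow
    X P₁ P₂ R₀ h ρ hR₀ hh hρ hX hP₁X hP₂X hcell hP₁ hP₂ Kw₁ Kw₂
  have hRT₁ : ((inPlaneRoots Fr 1).card : ℝ) ≤ 12 := by
    have : (inPlaneRoots Fr 1).card ≤ 12 := (card_le_card (filter_subset _ _)).trans (by rw [card_fccSlots])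
    exact_mod_cast this
  have hRT₂ : ((inPlaneRoots G₂ (-1)).card : ℝ) ≤ 12 := by
    have : (inPlaneRoots G₂ (-1)).card ≤ 12 := (card_le_card (filter_subset _ _)).trans (by rw [card_fccSlots])
    exact_mod_cast this
  have hρ0 : 0 ≤ ρ := by linarith
  have e1 := mul_le_mul_of_nonneg_right hRT₁ hρ0
  have e2 := mul_le_mul_of_nonneg_right hRT₂ hρ0
  push_cast at h1 h2
  nlinarith [h1, h2, hflux, e1, e2]

open scoped Classical in
/-- **The same under the ROOT-CLASS row `LocalEndRowRootA`** (`hexagon_twoPlate_flux_le_payerSum_root`, p749435). -/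
theorem hexagon_twoPlate_area_le_payerSum_root (ver : WordVersion) {δ : ℝ} (hg : KissingGap δ) (hc : KissingClassification δ)
    {σ₁ σ₂ : ℤ → ℤ} (hσ₁ : IsHaggSeq σ₁) (hσ₂ : IsHaggSeq σ₂) (L₁ L₂ : E3 ≃ₗᵢ[ℝ] E3) (s₁ s₂ : E3)
    (Fr : E3 ≃ₗᵢ[ℝ] E3) {t : ℤ} (hFr : (t = 1 ∧ Fr = L₁) ∨ (t = -1 ∧ Fr = basalMirror.trans L₁))
    (G₂ : E3 ≃ₗᵢ[ℝ] E3) {t' : ℤ} (hG₂ : (t' = 1 ∧ G₂ = L₂) ∨ (t' = -1 ∧ G₂ = basalMirror.trans L₂))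
    (hne₁ : (Fr : E3 → E3) '' ↑fccSlots ≠ (L₂ : E3 → E3) '' ↑fccSlots)
    (hne₂ : (Fr : E3 → E3) '' ↑fccSlots ≠ ((basalMirror.trans L₂ : E3 ≃ₗᵢ[ℝ] E3) : E3 → E3) '' ↑fccSlots)
    (hne₁' : (G₂ : E3 → E3) '' ↑fccSlots ≠ (L₁ : E3 → E3) '' ↑fccSlots)
    (hne₂' : (G₂ : E3 → E3) '' ↑fccSlots ≠ ((basalMirror.trans L₁ : E3 ≃ₗᵢ[ℝ] E3) : E3 → E3) '' ↑fccSlots)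
    {sF : ℝ} (hsF : 0 ≤ sF) (hrow : LocalEndRowRootA ver sF ⟨Fr, inPlaneRoots Fr 1⟩ ⟨G₂, inPlaneRoots G₂ (-1)⟩)
    (hadm₁ : ∀ k : ℤ, ¬ (σ₁ (k - 1) = -t ∧ σ₁ k = -t)) (hadm₂ : ∀ k : ℤ, ¬ (σ₂ (k - 1) = -t' ∧ σ₂ k = -t'))
    (X P₁ P₂ : Finset E3) (R₀ h ρ : ℝ) (hR₀ : 5 ≤ R₀) (hh : 0 ≤ h) (hρ : R₀ + 2 ≤ ρ)
    (hX : ∀ p ∈ X, ∀ q ∈ X, p ≠ q → 1 ≤ dist p q) (hP₁X : P₁ ⊆ X) (hP₂X : P₂ ⊆ X)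
    (hcell : ∀ p ∈ X, -(2 * R₀) ≤ p 2 ∧ p 2 ≤ h + 2 * R₀ ∧ p 0 ^ 2 + p 1 ^ 2 ≤ ρ ^ 2)
    (hP₁ : ∀ p, p ∈ P₁ ↔ (p ∈ stacking L₁ s₁ σ₁ ∧ -(2 * R₀) ≤ p 2 ∧ p 2 ≤ -R₀ ∧ p 0 ^ 2 + p 1 ^ 2 ≤ ρ ^ 2))
    (hP₂ : ∀ p, p ∈ P₂ ↔ (p ∈ stacking L₂ s₂ σ₂ ∧ h + R₀ ≤ p 2 ∧ p 2 ≤ h + 2 * R₀ ∧ p 0 ^ 2 + p 1 ^ 2 ≤ ρ ^ 2)) :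
    Real.sqrt 2 * Real.pi * ((∑ r ∈ inPlaneRoots Fr 1, (Fr r) 2) + ∑ r ∈ inPlaneRoots G₂ (-1), -(G₂ r) 2) * (ρ - 4) ^ 2 ≤
      sF * ∑ y ∈ X.filter (fun y => (X.filter fun q => dist y q = 1).card ≠ 12 ∧ -R₀ - 2 ≤ y 2 ∧ y 2 ≤ h + R₀ + 2),
          ((12 : ℝ) - ((X.filter fun q => dist y q = 1).card : ℝ)) +
        ((∑ r ∈ inPlaneRoots Fr 1, (X.filter fun b => -(R₀ + 1) - 1 ≤ b 2 ∧ b 2 < h + (R₀ + 1) + 1 ∧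
            (∃ μ, ⟪r, μ⟫_ℝ = Real.sqrt (2 / 3) ∧ IsTwinReading X Fr (Fr μ) b) ∧ b - Fr r ∈ X).card : ℕ) : ℝ) +
        ((∑ r ∈ inPlaneRoots G₂ (-1), (X.filter fun b => -(R₀ + 1) - 1 < b 2 ∧ b 2 ≤ h + (R₀ + 1) + 1 ∧
            (∃ μ, ⟪r, μ⟫_ℝ = Real.sqrt (2 / 3) ∧ IsTwinReading X G₂ (G₂ μ) b) ∧ b - G₂ r ∈ X).card : ℕ) : ℝ) +
        (3456 * sF + 1710840) * ρ := by
  have hρ4 : 4 ≤ ρ := by linarith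
  obtain ⟨Kw₁, h1⟩ := bottomPlate_flux_ge_area' σ₁ L₁ s₁ Fr hFr R₀ ρ hρ4 hadm₁
  obtain ⟨Kw₂, h2⟩ := topPlate_flux_ge_area' σ₂ L₂ s₂ G₂ hG₂ R₀ h ρ hρ4 hadm₂
  have hflux := hexagon_twoPlate_flux_le_payerSum_root ver hg hc hσ₁ hσ₂ L₁ L₂ s₁ s₂ Fr hFr G₂ hG₂ hne₁ hne₂ hne₁' hne₂' hsF hrow
    X P₁ P₂ R₀ h ρ hR₀ hh hρ hX hP₁X hP₂X hcell hP₁ hP₂ Kw₁ Kw₂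
  have hRT₁ : ((inPlaneRoots Fr 1).card : ℝ) ≤ 12 := by
    have : (inPlaneRoots Fr 1).card ≤ 12 := (card_le_card (filter_subset _ _)).trans (by rw [card_fccSlots])
    exact_mod_cast this
  have hRT₂ : ((inPlaneRoots G₂ (-1)).card : ℝ) ≤ 12 := by
    have : (inPlaneRoots G₂ (-1)).card ≤ 12 := (card_le_card (filter_subset _ _)).trans (by rw [card_fccSlots])
    exact_mod_cast this
  have hρ0 : 0 ≤ ρ := by linarith
  have e1 := mul_le_mul_of_nonneg_right hRT₁ hρ0
  have e2 := mul_le_mul_of_nonneg_right hRT₂ hρ0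
  push_cast at h1 h2
  nlinarith [h1, h2, hflux, e1, e2]

end Summit.Ventures.Crystal3D.Theorems

end
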